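import Literature.AnabelianGeometry.EtaleTheta.ThetaTrivializationsOfFunctionsModelChi
import HarnessLib

/-!
# [EtTh] Prop. 1.1 (ii) in the Kummer theory of functions: the LEVEL-`N` refinement of the `s`-dictionary
# datum (functions on `Z_N`, base automorphisms in `Gal(Z_N/X)`), `Prop11i ∧ Prop11ii ∧ Lem12` for it, and
# the instance at `modelχ`

S. Mochizuki, *The étale theta function …*, Publ. RIMS **45** (2009) [EtTh], §1 Prop. 1.1 (ii) (PRIMS PDF p. 15,
printed 241): "There is a unique action of `Π^tp_X` on `L_N ⊗_{O_{K_N}} O_{J_N}` … compatible with the morphism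
`Z_N → V(L_N ⊗ O_{J_N})` determined by `s_N` … this action factors through `Π^tp_X/Π^tp_{Z_N} = Gal(Z_N/X)`, and …
induces a faithful action of `Δ^tp_X/Δ^tp_{Z_N}`"; Lem. 1.2 (p. 19) [cite: MochizukiEtTh2009, Prop 1.1 (ii) p.15].
abc-iut cell, layer L2, seat abc-iut-w5-d171 (gen 7), row «LEM12-FD» (L2-lead R1045, condition (1)); sequel of
`ThetaTrivializationsOfFunctions.lean` (the `s`-dictionary datum `ThetaKummerInput.lineBundleData`, whose
Prop. 1.1 fields are at INFINITE level, so that `Prop11ii`'s kernel clauses fail: `not_prop11ii_lineBundleData`)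
and of `ThetaTrivializationsOfFunctionsModelChi.lean` (generator of `Λ(Fn)`, instance at `modelχ`).

WHAT (three small definitions + one datum, then proofs).
* `ThetaKummerInput.levelFn T N` — the functions ON `Z_N`: the fixed module `Fn^{Π^tp_{Z_N}}` (a subgroup);
  `levelAut T N : Π^tp_X →* MulAut (levelFn N)` — pull-back acts on it (`Π^tp_{Z_N} ⊴ Π^tp_X`); it kills
  `Π^tp_{Z_N}`, whence `levelAutQuot T N : Gal(Z_N/X) = Π^tp_X/Π^tp_{Z_N} →* MulAut (levelFn N)`.
* `ThetaKummerInput.lineBundleDataLevel T ξ hξ` — the `s`-dictionary datum with its Prop. 1.1 fields AT LEVEL `N`: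
  `Γ(Z_N, L_N) := levelFn N` (sections `σ ↦ s_N/σ`), `s₁ ↔ 1`, `powN = (·)^N`;
  `Aut(V(L_N ⊗ O_{J_N}) / Y_N × J_N) := levelFn N ⋊ Gal(Z_N/X)` (fibre scalar = invertible function on `Z_N`, base
  automorphism recorded by its class in `Gal(Z_N/X)`, acting on functions through `levelAutQuot`); "compatible with
  the morphism determined by `s_N`" `:⟺` covers the tautological base action `g ↦ [g]` and fixes `s_N`.  The
  Lem. 1.2 fields are LITERALLY those of `lineBundleData` (structure update).
* `prop11ii_lineBundleDataLevel` — **Prop. 1.1 (ii) HOLDS for it, all four clauses**: the compatible action is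
  `g ↦ (s_N / g•s_N, [g])`, it is unique, its kernel is EXACTLY `Π^tp_{Z_N}` (so `Π^tp_{Z_N} ≤ Ker` and
  `Ker ∩ Δ^tp_X = Δ^tp_{Z_N}`: "factors through `Gal(Z_N/X)`", "faithful action of `Δ^tp_X/Δ^tp_{Z_N}`").
  `prop11i_lineBundleDataLevel` (trivial), and `lem12_lineBundleDataLevel(_of_deck)` /
  `preserves_one_iff_of_mem_GtpYdd_level` / `preserves_one_iff_of_deck_level` TRANSFERRED verbatim from the parent
  file (same Lem. 1.2 fields).
* `SettingModel.exists_lineBundleData_facts_modelχ` — **at `modelχ`: `∃ L, Prop11i L ∧ Prop11ii L ∧ Lem12 L ∧`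
  the level-1 sign law** (p454127's function module; F-0653/F-0654/F-0655 instance forms all witnessed in the
  Kummer theory of functions, with the discrepancy `−1 ≠ 1` realised — at the toy datum it is `1` throughout).

HONEST FRAMING.  A dictionary over a theta-Kummer input, instanced at a SEMI-SYNTHETIC model (consistency evidence
for the typed interface only) — NOT a curve carrier: `Y_N`, `Z_N`, `L_N`, `Ÿ_N`, `L̈_N`, `D_N` still have no carrier
(plan/FOUNDATIONS.md row 14 unchanged); the node classes EtTh:Prop1.1(i)(ii) / EtTh:Lem1.2 stay FACT-policy (L2
R963/R1032).  Nothing of [EtTh] is asserted; no side is taken on [IUTchIII] Cor. 3.12; typed ≠ proved.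
-/

noncomputable section

namespace Literature.AnabelianGeometry.EtaleTheta

open Literature.AnabelianGeometry.SemiGraphs

namespace ThetaSetting

namespace ThetaKummerInput

variable {p : ℕ} [Fact p.Prime] {D : ThetaSetting p} (T : D.ThetaKummerInput)

/-! ### The functions on `Z_N` and the action of `Gal(Z_N/X)` on them -/

/-- **The functions on `Z_N`**: the fixed module `Fn^{Π^tp_{Z_N}}` of the functions on the coverings.
[cite: MochizukiEtTh2009, Prop 1.1 (ii) p.15] -/
def levelFn (N : ℕ+) : Subgroup T.Fn := FixedPoints.subgroup (↥(D.GtpZN N)) T.Fn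

/-- Membership in `Fn^{Π^tp_{Z_N}}`. [cite: MochizukiEtTh2009, Prop 1.1 (ii) p.15] -/
theorem mem_levelFn_iff (N : ℕ+) (f : T.Fn) : f ∈ T.levelFn N ↔ ∀ z ∈ D.GtpZN N, z • f = f := by
  rw [levelFn, FixedPoints.mem_subgroup]
  exact ⟨fun h z hz => h ⟨z, hz⟩, fun h z => h z z.2⟩

/-- `Π^tp_X` preserves `Fn^{Π^tp_{Z_N}}` (`Π^tp_{Z_N} ⊴ Π^tp_X`). [cite: MochizukiEtTh2009, Prop 1.1 (ii) p.15] -/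
theorem smul_mem_levelFn (N : ℕ+) {f : T.Fn} (hf : f ∈ T.levelFn N) (g : D.PiTemp) : g • f ∈ T.levelFn N := by
  rw [mem_levelFn_iff] at hf ⊢
  intro z hz
  have hz' : g⁻¹ * z * g ∈ D.GtpZN N := by
    have h := (D.GtpZN_normal N).conj_mem z hz g⁻¹
    rwa [inv_inv] at h
  rw [← mul_smul, show z * g = g * (g⁻¹ * z * g) by group, mul_smul, hf _ hz']

/-- **Pull-back acts on the functions on `Z_N`**: `Π^tp_X →* Aut(Fn^{Π^tp_{Z_N}})`.
[cite: MochizukiEtTh2009, Prop 1.1 (ii) p.15] -/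
def levelAut (N : ℕ+) : D.PiTemp →* MulAut (T.levelFn N) where
  toFun g :=
    { toFun := fun a => ⟨g • (a : T.Fn), T.smul_mem_levelFn N a.2 g⟩
      invFun := fun a => ⟨g⁻¹ • (a : T.Fn), T.smul_mem_levelFn N a.2 g⁻¹⟩
      left_inv := fun a => Subtype.ext (inv_smul_smul g (a : T.Fn))
      right_inv := fun a => Subtype.ext (smul_inv_smul g (a : T.Fn))
      map_mul' := fun a b => Subtype.ext (smul_mul' g (a : T.Fn) (b : T.Fn)) }
  map_one' := MulEquiv.ext fun a => Subtype.ext (one_smul D.PiTemp (a : T.Fn))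
  map_mul' g h := MulEquiv.ext fun a => Subtype.ext (mul_smul g h (a : T.Fn))

/-- Values of `levelAut`. [cite: MochizukiEtTh2009, Prop 1.1 (ii) p.15] -/
@[simp] theorem coe_levelAut_apply (N : ℕ+) (g : D.PiTemp) (a : T.levelFn N) :
    ((T.levelAut N g) a : T.Fn) = g • (a : T.Fn) := rfl

/-- `Π^tp_{Z_N}` acts trivially on the functions on `Z_N`. [cite: MochizukiEtTh2009, Prop 1.1 (ii) p.15] -/
theorem GtpZN_le_ker_levelAut (N : ℕ+) : D.GtpZN N ≤ (T.levelAut N).ker := fun z hz => by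
  rw [MonoidHom.mem_ker]
  refine MulEquiv.ext fun a => Subtype.ext ?_
  rw [coe_levelAut_apply]
  exact (T.mem_levelFn_iff N a).mp a.2 z hz

/-- **`Gal(Z_N/X) = Π^tp_X/Π^tp_{Z_N}` acts on the functions on `Z_N`** ("this action … factors through
`Π^tp_X/Π^tp_{Z_N} = Gal(Z_N/X)`"). [cite: MochizukiEtTh2009, Prop 1.1 (ii) p.15] -/
def levelAutQuot (N : ℕ+) :
    letI := D.GtpZN_normal N; D.PiTemp ⧸ D.GtpZN N →* MulAut (T.levelFn N) :=
  letI := D.GtpZN_normal N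
  QuotientGroup.lift (D.GtpZN N) (T.levelAut N) (T.GtpZN_le_ker_levelAut N)

/-! ### The level-`N` refinement of the `s`-dictionary datum -/

/-- **The `s`-dictionary datum with its Prop. 1.1 fields at level `N`**: `Γ(Z_N, L_N) := Fn^{Π^tp_{Z_N}}`
(sections `σ ↦ s_N/σ`, `s₁ ↔ 1`, `powN = (·)^N`); `Aut(V(L_N ⊗ O_{J_N})) := Fn^{Π^tp_{Z_N}} ⋊ Gal(Z_N/X)` acting on
sections by `σ ↦ u · (g • σ)`; "compatible with the morphism determined by `s_N`" `:⟺` covers `g ↦ [g]` and fixes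
`s_N`.  The Lem. 1.2 fields are those of `lineBundleData` (structure update).  An INTERPRETATION of the free
interface; nothing of print is asserted. [cite: MochizukiEtTh2009, Prop 1.1 (ii) p.15] -/
def lineBundleDataLevel (ξ : cyclotome T.Fn) (hξ : ∀ N : ℕ+, IsPrimitiveRoot ((ξ : ℕ+ → T.Fn) N) N) :
    D.LineBundleData :=
  { T.lineBundleData ξ hξ with
    SecPow := fun N => T.levelFn N
    Sec := fun N => T.levelFn N
    powN := fun N f => f ^ (N : ℕ)
    s₁res := fun _ => 1
    AutV := fun N => letI := D.GtpZN_normal N; T.levelFn N ⋊[T.levelAutQuot N] (D.PiTemp ⧸ D.GtpZN N)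
    instGroupAutV := fun N => by letI := D.GtpZN_normal N; infer_instance
    IsCompatibleWith := fun N ρ s => letI := D.GtpZN_normal N
      ∀ g : D.PiTemp, (ρ g).right = (g : D.PiTemp ⧸ D.GtpZN N) ∧ ((ρ g).left : T.Fn) * g • (s : T.Fn) = s }

variable (ξ : cyclotome T.Fn) (hξ : ∀ N : ℕ+, IsPrimitiveRoot ((ξ : ℕ+ → T.Fn) N) N)

/-! ### Prop. 1.1 (i), (ii) for the level datum -/

/-- **Prop. 1.1 (i)** for the level datum (trivially: `s₁ ↔ 1`). [cite: MochizukiEtTh2009, Prop 1.1 (i) p.15] -/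
theorem prop11i_lineBundleDataLevel : Prop11i (T.lineBundleDataLevel ξ hξ) := fun N =>
  ⟨(1 : T.levelFn N), (one_pow (N : ℕ) : (1 : T.levelFn N) ^ (N : ℕ) = 1)⟩

/-- **Prop. 1.1 (ii) HOLDS for the level datum, all four clauses**: for a root `s_N` (of `s₁ ↔ 1`) on `Z_N`, the
compatible action is `g ↦ (s_N / g•s_N, [g])`, it is unique, and its kernel is exactly `Π^tp_{Z_N}` — so it
"factors through `Gal(Z_N/X)`" and "induces a faithful action of `Δ^tp_X/Δ^tp_{Z_N}`".
[cite: MochizukiEtTh2009, Prop 1.1 (ii) p.15] -/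
theorem prop11ii_lineBundleDataLevel : Prop11ii (T.lineBundleDataLevel ξ hξ) := by
  intro N s _
  letI := D.GtpZN_normal N
  change ↥(T.levelFn N) at s
  -- the discrepancy `s_N / g•s_N`, a function on `Z_N`
  have hs : ∀ g : D.PiTemp, (s : T.Fn) / g • (s : T.Fn) ∈ T.levelFn N := fun g =>
    div_mem s.2 (T.smul_mem_levelFn N s.2 g)
  let w : D.PiTemp → T.levelFn N := fun g => ⟨(s : T.Fn) / g • (s : T.Fn), hs g⟩
  have w_coe : ∀ g, ((w g : T.levelFn N) : T.Fn) = (s : T.Fn) / g • (s : T.Fn) := fun _ => rfl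
  let ρ : D.PiTemp →* T.levelFn N ⋊[T.levelAutQuot N] (D.PiTemp ⧸ D.GtpZN N) :=
    { toFun := fun g => ⟨w g, g⟩
      map_one' := by
        ext
        · change (s : T.Fn) / (1 : D.PiTemp) • (s : T.Fn) = 1
          rw [one_smul, div_self']
        · rfl
      map_mul' := fun g h => by
        ext
        · change (s : T.Fn) / (g * h) • (s : T.Fn) =
            (w g : T.Fn) * ((T.levelAutQuot N (g : D.PiTemp ⧸ D.GtpZN N)) (w h) : T.Fn)
          rw [levelAutQuot, QuotientGroup.lift_mk, coe_levelAut_apply, w_coe, w_coe, mul_smul, smul_div',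
            div_mul_div_cancel]
        · rfl }
  have ρ_apply : ∀ g, ρ g = ⟨w g, g⟩ := fun _ => rfl
  -- its kernel is exactly `Π^tp_{Z_N}`
  have hker : ρ.ker = D.GtpZN N := by
    ext g
    rw [MonoidHom.mem_ker, ρ_apply]
    constructor
    · intro h
      have h2 : ((g : D.PiTemp ⧸ D.GtpZN N)) = 1 := congrArg SemidirectProduct.right h
      exact (QuotientGroup.eq_one_iff g).mp h2
    · intro hg
      ext
      · change (s : T.Fn) / g • (s : T.Fn) = 1
        rw [(T.mem_levelFn_iff N s).mp s.2 g hg, div_self']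
      · exact (QuotientGroup.eq_one_iff g).mpr hg
  refine ⟨ρ, fun g => ⟨rfl, ?_⟩, fun ρ' hρ' => ?_, hker.ge, ?_⟩
  · -- compatible: fixes `s_N`
    change (s : T.Fn) / g • (s : T.Fn) * g • (s : T.Fn) = s
    rw [div_mul_cancel]
  · -- unique
    refine MonoidHom.ext fun g => ?_
    obtain ⟨h1, h2⟩ := hρ' g
    show ρ' g = (⟨w g, (g : D.PiTemp ⧸ D.GtpZN N)⟩ : T.levelFn N ⋊[T.levelAutQuot N] (D.PiTemp ⧸ D.GtpZN N))
    refine SemidirectProduct.ext ?_ ?_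
    · exact Subtype.ext (eq_div_of_mul_eq' h2)
    · exact h1
  · -- `Ker ∩ Δ^tp_X = Δ^tp_{Z_N}`
    change ρ.ker ⊓ D.DeltaTemp = D.GtpZN N ⊓ D.DeltaTemp
    rw [hker]

/-! ### Lem. 1.2 and the sign law, transferred (same Lem. 1.2 fields) -/

/-- **Lem. 1.2 for the level datum** (its Lem. 1.2 fields are those of `lineBundleData`).
[cite: MochizukiEtTh2009, Lem 1.2 p.19] -/
theorem lem12_lineBundleDataLevel
    (hgen : ∀ (x : cyclotome T.Fn) (N : ℕ+), ∃ k : ℤ, (x : ℕ+ → T.Fn) N = (ξ : ℕ+ → T.Fn) N ^ k)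
    (hsq : ∀ g : D.PiTemp, g ∈ D.GtpY → (T.theta / (g • T.theta)) ^ 2 = 1) :
    Lem12 (T.lineBundleDataLevel ξ hξ) :=
  T.lem12_lineBundleData ξ hξ hgen hsq

/-- Lem. 1.2 for the level datum, from the deck identity. [cite: MochizukiEtTh2009, Lem 1.2 p.19] -/
theorem lem12_lineBundleDataLevel_of_deck
    (hgen : ∀ (x : cyclotome T.Fn) (N : ℕ+), ∃ k : ℤ, (x : ℕ+ → T.Fn) N = (ξ : ℕ+ → T.Fn) N ^ k)
    (hdeck : ∀ ε : D.PiTemp, ε ∈ D.GtpY → ε ∉ D.GtpYdd → ε • T.theta = T.const (-1) * T.theta) :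
    Lem12 (T.lineBundleDataLevel ξ hξ) :=
  T.lem12_lineBundleData_of_deck ξ hξ hgen hdeck

/-- On `Π^tp_Ÿ` the correcting root of unity at level 1 is `+1` (level datum). [cite: MochizukiEtTh2009, Lem 1.2 p.19] -/
theorem preserves_one_iff_of_mem_GtpYdd_level {g : D.PiTemp} (hgY : g ∈ D.GtpY) (hg : g ∈ D.GtpYdd)
    (ζ : Multiplicative (ZMod (2 * ((1 : ℕ+) : ℕ)))) :
    (T.lineBundleDataLevel ξ hξ).Preserves 1
        ((T.lineBundleDataLevel ξ hξ).rootAct 1 ζ * (T.lineBundleDataLevel ξ hξ).actProp11 1 ⟨g, hgY⟩)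
        (T.thetaRoots.root 1) ↔ ζ = 1 :=
  T.preserves_one_iff_of_mem_GtpYdd ξ hξ hgY hg ζ

/-- Off `Π^tp_Ÿ` (deck identity) the correcting root of unity at level 1 is `−1` (level datum).
[cite: MochizukiEtTh2009, Lem 1.2 p.19] -/
theorem preserves_one_iff_of_deck_level
    (hgen : ∀ (x : cyclotome T.Fn) (N : ℕ+), ∃ k : ℤ, (x : ℕ+ → T.Fn) N = (ξ : ℕ+ → T.Fn) N ^ k)
    (hneg : T.const (-1) ≠ 1) {g : D.PiTemp} (hgY : g ∈ D.GtpY)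
    (hdeck : g • T.theta = T.const (-1) * T.theta) (ζ : Multiplicative (ZMod (2 * ((1 : ℕ+) : ℕ)))) :
    (T.lineBundleDataLevel ξ hξ).Preserves 1
        ((T.lineBundleDataLevel ξ hξ).rootAct 1 ζ * (T.lineBundleDataLevel ξ hξ).actProp11 1 ⟨g, hgY⟩)
        (T.thetaRoots.root 1) ↔ ζ ≠ 1 :=
  T.preserves_one_iff_of_deck ξ hξ hgen hneg hgY hdeck ζ

end ThetaKummerInput

end ThetaSetting

/-! ### The instance at `modelχ`: all three instance forms -/

namespace SettingModel

variable (p : ℕ) [Fact p.Prime]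

/-- **[EtTh] Prop. 1.1 (i), (ii) AND Lem. 1.2 WITNESSED TOGETHER AT `modelχ` in the Kummer theory of functions,
with the sign mechanism**: there is a line-bundle datum over `modelχ` — the level-refined `s`-dictionary of
abc-iut-w5-d125's function module (p454127) — satisfying `Prop11i ∧ Prop11ii ∧ Lem12`, together with the
level-1 sign law (the correcting root of unity is `1` iff `g ∈ Π^tp_Ÿ`).  SEMI-SYNTHETIC model; consistency
evidence for the typed interface only; nothing of [EtTh] asserted. [cite: MochizukiEtTh2009, Prop 1.1 (ii) p.15] -/
theorem exists_lineBundleData_facts_modelχ :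
    ∃ L : (ThetaSetting.modelχ p).LineBundleData,
      ThetaSetting.Prop11i L ∧ ThetaSetting.Prop11ii L ∧ ThetaSetting.Lem12 L ∧
      ∃ τ : L.SecDd 1, L.IsThetaTriv 1 τ ∧
        ∀ (g : (ThetaSetting.modelχ p).PiTemp) (hg : g ∈ (ThetaSetting.modelχ p).GtpY)
          (ζ : Multiplicative (ZMod (2 * ((1 : ℕ+) : ℕ)))),
          L.Preserves 1 (L.rootAct 1 ζ * L.actProp11 1 ⟨g, hg⟩) τ ↔
            (ζ = 1 ↔ g ∈ (ThetaSetting.modelχ p).GtpYdd) := by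
  obtain ⟨T, hbij, hcc, hdeck⟩ := exists_thetaKummerInput_deck_modelχ p
  letI := T.instAction
  let E₁ : cyclotome T.Fn ≃* (ThetaSetting.modelχ p).DeltaTheta := MulEquiv.ofBijective T.coeff.hom hbij
  let E₂ : ZH ≃* (ThetaSetting.modelχ p).DeltaTheta :=
    MulEquiv.ofBijective (deltaThetaCoordχ p) (bijective_deltaThetaCoordχ p)
  let Φ : ZH ≃* cyclotome T.Fn := E₂.trans E₁.symm
  obtain ⟨hξ, hgen⟩ := T.generator_of_mulEquiv_zHat Φ
  have hneg : T.const (-1) ≠ 1 := T.const_neg_one_ne_one_of_constCompat hcc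
  refine ⟨T.lineBundleDataLevel _ hξ, T.prop11i_lineBundleDataLevel _ hξ, T.prop11ii_lineBundleDataLevel _ hξ,
    T.lem12_lineBundleDataLevel_of_deck _ hξ hgen hdeck, T.thetaRoots.root 1, ⟨1, ?_⟩, fun g hg ζ => ?_⟩
  · rw [map_one, one_mul, T.thetaRoots.root_one, PNat.one_coe, pow_one]
  · by_cases hdd : g ∈ (ThetaSetting.modelχ p).GtpYdd
    · rw [T.preserves_one_iff_of_mem_GtpYdd_level _ hξ hg hdd ζ]
      simp only [hdd, iff_true]
    · rw [T.preserves_one_iff_of_deck_level _ hξ hgen hneg hg (hdeck g hg hdd) ζ]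
      simp only [hdd, iff_false]

end SettingModel

end Literature.AnabelianGeometry.EtaleTheta

end
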